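import Literature.Analysis.Complex.JensenCircles
import Literature.NumberTheory.LFunctions.RiemannXiProofs
import Literature.NumberTheory.LFunctions.RiemannXiOrderProofs
import Literature.NumberTheory.LFunctions.XiMoments
import Mathlib.Analysis.Calculus.IteratedDeriv.Lemmas
import HarnessLib

/-!
# The zeros of `ξ^{(m)}` lie in the open critical strip, for every `m` (Conrey 1983, Lemma 2 — first statement)

RH-FREE (the last section consists of implications `RiemannHypothesis → …`, i.e. RH-CONDITIONAL
statements proved as implications; nothing is assumed). Nothing here bears on the truth of RH.
PROOF LAYER for `XiDerivativeZeros.lean` (J. B. Conrey, *Zeros of derivatives of Riemann's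
ξ-function on the critical line*, J. Number Theory **16** (1983) 49–74, key `Conrey1983`).

Conrey's Lemma 2 (p. 52) opens: "Any zero of `ξ^{(m)}(s)` satisfies `0 < σ < 1`." Printed proof:
"by induction on `m`. We apply Hadamard's factorization theorem to `ξ^{(m)}(s)` which is entire and
of order one since `ξ(s)` is. Then by logarithmic differentiation of the product and use of the
symmetry of the zeros about the real axis and about the line `σ = ½` (which follows from the
functional equation `ξ^{(m)}(s) = (−1)^m ξ^{(m)}(1 − s)`) we conclude that
`Re (ξ^{(m+1)}(s)/ξ^{(m)}(s))` cannot vanish unless `0 < σ < 1`." The tree had the case `m = 1`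
(`Conrey1983_lemma2_xiDeriv_strip`, `XiDerivativeZerosCounting.lean`) and, under RH, the case
`m = 1` of Conrey's remark (p. 49) "the Riemann hypothesis implies that all of the zeros of
`ξ^{(m)}(s)` … have real part `½` for any `m`" (`riemannHypothesis_imp_xiDeriv_zeros_on_line_holds`).

This file proves both statements FOR EVERY `m`, together with Conrey's displayed inequality
`Re ξ^{(m+1)}/ξ^{(m)}(s) > 0` for `Re s ≥ 1` (and, under RH, for `Re s > ½`). DEVIATION FROM THE
PRINTED PROOF (a shorter road the tree already provides): instead of Hadamard's factorisation we
use the tree's Hadamard-free **Jensen circle theorem** for real entire functions of order `< 2`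
(`Literature/Analysis/Complex/JensenCircles.lean`: Ki–Kim 2000, §2; from Titchmarsh's Lemma α),
applied to `Ξ(z) = ξ(½ + iz)` and its derivatives `Ξ^{(k)}(z) = i^k ξ^{(k)}(½ + iz)`: a non-real
zero `w` of `Ξ^{(k+1)}` lies in a Jensen disc `(Re w − Re a)² + (Im w)² ≤ (Im a)²` of a zero `a` of
`Ξ^{(k)}`, so `|Im w| ≤ |Im a| < ½` propagates the OPEN strip `|Im z| < ½` (i.e. `0 < σ < 1`) from
`Ξ` (Titchmarsh §2.12, tree `riemannXi_eq_zero_iff_holds`) to all derivatives — this is exactly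
Conrey's "symmetry about the real axis and about `σ = ½`" bookkeeping, with conjugate zeros of `Ξ`
paired. Conrey's positivity is the sign of `Im (f′/f)` outside all Jensen discs
(`XiDerivStrip.im_mul_im_logDeriv_neg`, the computation inside the tree's `jensen_circle`, here
run with `f′(w) ≠ 0`): `Re (ξ^{(m+1)}/ξ^{(m)})(½ + iz) = Im (Ξ_m′/Ξ_m)(z)`.

## Contents (all PROVED, standard axioms)

* `XiDerivStrip.abs_im_lt_of_iteratedDeriv_eq_zero`
  (strict form of the tree's `abs_im_le_of_iteratedDeriv_eq_zero`),
  `XiDerivStrip.im_mul_im_logDeriv_neg` — generic complements to `JensenCircles.lean`.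
* `XiDerivStrip.differentiable_xiUpper`, `iteratedDeriv_riemannXiUpper`
  (`Ξ^{(n)}(z) = iⁿ ξ^{(n)}(½ + iz)`), `iteratedDeriv_riemannXiUpper_neg` (parity),
  `iteratedDeriv_riemannXiUpper_ne_zero` (`Ξ^{(n)} ≢ 0`, from `ξ^{(2k)}(½) > 0`, tree
  `iteratedDeriv_two_mul_riemannXi_half_pos`), `exists_growth_riemannXiUpper` (`Ξ` has order `< 2`
  in the tree's quantitative sense, from `riemannXi_order_le_one_holds`),
  `exists_iteratedDeriv_riemannXiUpper_eq_zero` (every `Ξ^{(m)}` has a zero).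
* **`Conrey1983_lemma2_strip`** — `ξ^{(m)}(s) = 0 ⇒ 0 < Re s < 1`, every `m`; Ξ-form
  `abs_im_lt_half_of_iteratedDeriv_riemannXiUpper_eq_zero`; `deriv`-forms for `ξ″` and `Ξ′`.
* **`re_iteratedDeriv_succ_div_pos_of_one_le_re`** — `Re ξ^{(m+1)}/ξ^{(m)}(s) > 0` for `Re s ≥ 1`
  (Conrey's display), with the `m = 1` `deriv`-form `re_deriv2_div_deriv_riemannXi_pos_of_one_le_re`
  (the quantity `Re ξ″/ξ′` of the Matiyasevich–Saidak–Zvengrowski monotone-modulus criterion).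
* **`riemannHypothesis_imp_iteratedDeriv_riemannXi_zeros_on_line`** — RH ⇒ every zero of every
  `ξ^{(m)}` is on `Re s = ½` (Conrey p. 49, "for any `m`"; Levinson–Montgomery 1974); Ξ-form, the
  `Ξ′`-form `riemannHypothesis_imp_deriv_riemannXiUpper_zeros_real`, and
  `riemannHypothesis_imp_re_iteratedDeriv_succ_div_pos` (RH ⇒ `Re ξ^{(m+1)}/ξ^{(m)} > 0` on `Re s > ½`).

Status: Conrey 1983 is a refereed paper; Lemma 2 (first part) is classical (Levinson–Montgomery
1974 §2 for `m = 1`). AI-produced formalisation (literature-prover-rh-lit-frontier-1-g12-0,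
2026-08-27); AI review is weaker than expert review. No endorsement of any preprint is implied.

## References

* J. B. Conrey, J. Number Theory 16 (1983) 49–74: §1 (p. 49), Lemma 2 (p. 52). [key `Conrey1983`]
* N. Levinson, H. L. Montgomery, *Zeros of the derivatives of the Riemann zeta-function*, Acta
  Math. 133 (1974) 49–65, §2. [key `LevinsonMontgomery1974`]
* H. Ki, Y.-O. Kim, Duke Math. J. 104 (2000) 45–73, §2 (Jensen's theorem). [key `KiKim2000`]
-/

noncomputable section

open Complex Filter Set Topology
open scoped ComplexConjugate

namespace Literature.NumberTheory.LFunctions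

open Literature.Analysis.Complex

/-! ## Generic complements to the Jensen circle theorem -/

namespace XiDerivStrip

variable {f : ℂ → ℂ}

/-- Absorption of a constant factor into a larger exponent: for `0 ≤ p < p'` and any `c` there is
`K ≥ 0` with `c r^p ≤ K + r^{p'}` for all `r ≥ 0`. [folklore] -/
private theorem exists_const_mul_rpow_le (c : ℝ) {p p' : ℝ} (hp : 0 ≤ p) (hpp' : p < p') :
    ∃ K : ℝ, 0 ≤ K ∧ ∀ r : ℝ, 0 ≤ r → c * r ^ p ≤ K + r ^ p' := by
  rcases le_or_gt c 0 with hc | hc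
  · refine ⟨0, le_rfl, fun r hr ↦ ?_⟩
    have h1 : c * r ^ p ≤ 0 := mul_nonpos_of_nonpos_of_nonneg hc (Real.rpow_nonneg hr _)
    have h2 : 0 ≤ r ^ p' := Real.rpow_nonneg hr _
    linarith
  · have hδ : 0 < p' - p := sub_pos.2 hpp'
    set R₀ : ℝ := c ^ (p' - p)⁻¹ with hR₀
    have hR₀0 : 0 ≤ R₀ := Real.rpow_nonneg hc.le _
    have hK0 : 0 ≤ c * (R₀ + 1) ^ p := mul_nonneg hc.le (Real.rpow_nonneg (by linarith) _)
    refine ⟨c * (R₀ + 1) ^ p, hK0, fun r hr ↦ ?_⟩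
    rcases le_or_gt r (R₀ + 1) with h | h
    · have : c * r ^ p ≤ c * (R₀ + 1) ^ p :=
        mul_le_mul_of_nonneg_left (Real.rpow_le_rpow hr h hp) hc.le
      linarith [Real.rpow_nonneg hr p']
    · have hr0 : 0 < r := by linarith
      have h1 : c ≤ r ^ (p' - p) := by
        calc c = R₀ ^ (p' - p) := by rw [hR₀, Real.rpow_inv_rpow hc.le hδ.ne']
          _ ≤ r ^ (p' - p) := Real.rpow_le_rpow hR₀0 (by linarith) hδ.le
      have h2 : r ^ p' = r ^ (p' - p) * r ^ p := by
        rw [← Real.rpow_add hr0]; ring_nf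
      have h3 : c * r ^ p ≤ r ^ (p' - p) * r ^ p :=
        mul_le_mul_of_nonneg_right h1 (Real.rpow_nonneg hr _)
      rw [← h2] at h3
      linarith

/-- **Strict strip heredity.** For `f` real entire of order `< 2` with no derivative `≡ 0`: if all
zeros of `f` satisfy `|Im z| < Δ` (`Δ > 0`), then so do all zeros of every `f^{(k)}` (a zero `w` of
`f^{(k+1)}` with `Im w > 0` lies in a Jensen disc of a zero `a` of `f^{(k)}` with `Im a > 0`, whence
`Im w ≤ Im a`; Ki–Kim 2000, Remark 2.2 (b), strict form). [cite: KiKim2000, §2 p. 50 and Remark 2.2 (b)] -/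
theorem abs_im_lt_of_iteratedDeriv_eq_zero (hf : Differentiable ℂ f) {ρ C : ℝ} (hρ0 : 0 ≤ ρ)
    (hρ : ρ < 2) (hgr : ∀ z, ‖f z‖ ≤ C * Real.exp (‖z‖ ^ ρ)) (hreal : ∀ x : ℝ, (f x).im = 0)
    (hnz : ∀ n : ℕ, iteratedDeriv n f ≠ 0) {Δ : ℝ} (hΔ : 0 < Δ)
    (hstrip : ∀ z, f z = 0 → |z.im| < Δ) (k : ℕ) {z : ℂ} (hz : iteratedDeriv k f z = 0) :
    |z.im| < Δ := by
  induction k generalizing z with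
  | zero => exact hstrip z (by simpa using hz)
  | succ k ih =>
    have hrefl : ∀ u : ℂ, iteratedDeriv (k + 1) f (conj u) = conj (iteratedDeriv (k + 1) f u) :=
      fun u ↦ apply_conj_eq_conj (differentiable_iteratedDeriv_of_entire hf (k + 1))
        (im_iteratedDeriv_ofReal hf hreal (k + 1)) u
    have key : ∀ u : ℂ, 0 < u.im → iteratedDeriv (k + 1) f u = 0 → |u.im| < Δ := by
      intro u hu hfu
      obtain ⟨a, ha, ha0, hdisc⟩ :=
        jensen_circle_iteratedDeriv_pos hf hρ0 hρ hgr hreal hnz k hu hfu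
      have h1 := ih ha
      rw [abs_of_pos hu]
      rw [abs_of_pos ha0] at h1
      nlinarith [sq_nonneg (u.re - a.re)]
    rcases lt_trichotomy z.im 0 with hneg | h0 | hpos
    · have h := key (conj z) (by simpa using hneg) (by rw [hrefl, hz, map_zero])
      simpa using h
    · rw [h0, abs_zero]; exact hΔ
    · exact key z hpos hz

/-- **The sign of `Im (f′/f)` outside the Jensen discs** (the computation in the proof of Jensen's
theorem, Ki–Kim 2000 §2 p. 50: `Im (1/(z − c) + 1/(z − c̄)) = −2 (Im z)(|z − Re c|² − (Im c)²)/…`).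
Let `f` be real entire of order `< 2` with at least one zero, and let `w` be non-real and strictly
outside every closed Jensen disc: `|Im a| < |w − Re a|` for every zero `a` of `f`. Then
`(Im w) · Im (f′/f)(w) < 0`. (Titchmarsh's Lemma α at `w` and `w̄`, averaged by Schwarz reflection,
pairs every zero with its conjugate; each pair contributes `≤ 0`, a fixed pair `< 0`.)
[cite: KiKim2000, §2 p. 50 (Jensen's theorem, proof)] -/
theorem im_mul_im_logDeriv_neg (hf : Differentiable ℂ f) {ρ C : ℝ} (hρ0 : 0 ≤ ρ) (hρ : ρ < 2)
    (hgr : ∀ z, ‖f z‖ ≤ C * Real.exp (‖z‖ ^ ρ)) (hreal : ∀ x : ℝ, (f x).im = 0)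
    (hex : ∃ a, f a = 0) {w : ℂ} (hw : w.im ≠ 0)
    (hout : ∀ a, f a = 0 → |a.im| < ‖w - a.re‖) :
    w.im * (deriv f w / f w).im < 0 := by
  classical
  have hfw0 : f w ≠ 0 := by
    intro h0
    have h := hout w h0
    have e : w - (w.re : ℂ) = (w.im : ℂ) * I := by apply Complex.ext <;> simp
    rw [e, norm_mul, Complex.norm_I, mul_one, Complex.norm_real, Real.norm_eq_abs] at h
    exact lt_irrefl _ h
  have hfw0' : f (conj w) ≠ 0 := by
    rw [apply_conj_eq_conj hf hreal, map_ne_zero]; exact hfw0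
  obtain ⟨a₀, ha₀⟩ := hex
  obtain ⟨c, hc⟩ := exists_ofReal_ne_zero hf ⟨w, hfw0⟩
  obtain ⟨-, hκ⟩ := im_mul_im_pair_le (hout a₀ ha₀) hw (le_refl 1)
  set κ : ℝ := 2 * w.im ^ 2 * (‖w - a₀.re‖ ^ 2 - a₀.im ^ 2) /
    (‖w - a₀‖ ^ 2 * ‖w - conj a₀‖ ^ 2) with hκdef
  have hε : 0 < κ / (2 * (|w.im| + 1)) := by positivity
  obtain ⟨S, m, ψ₁, ψ₂, hS, hS', h1, h2, hψ⟩ :=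
    exists_logDeriv_eq_sum_pair hf hρ0 hρ hgr hc hfw0 hfw0' ‖a₀ - c‖ hε
  have ha₀S : a₀ ∈ S := hS' a₀ ha₀ le_rfl
  set g : ℂ := deriv f w / f w with hgdef
  -- the expansion at `w̄`, conjugated: `g = ∑ m(a)/(w - ā) + conj ψ₂`
  have hg2 : deriv f (conj w) / f (conj w) = conj g := by
    rw [hgdef, logDeriv_apply_conj hf hreal]
  have h2' : g = ∑ a ∈ S, (m a : ℂ) / (w - conj a) + conj ψ₂ := by
    have h2c : conj g = ∑ a ∈ S, (m a : ℂ) / (conj w - a) + ψ₂ := by rw [← hg2]; exact h2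
    have := congrArg conj h2c
    rw [Complex.conj_conj, map_add, map_sum] at this
    rw [this]
    congr 1
    refine Finset.sum_congr rfl fun a _ ↦ ?_
    rw [map_div₀, map_natCast, map_sub, Complex.conj_conj]
  -- add up and take `(Im w) · Im`
  have hsum : ∑ a ∈ S, w.im * ((m a : ℂ) / (w - a) + (m a : ℂ) / (w - conj a)).im =
      w.im * (g.im + g.im - ψ₁.im + ψ₂.im) := by
    have e : ∑ a ∈ S, ((m a : ℂ) / (w - a) + (m a : ℂ) / (w - conj a)) =
        g + g - ψ₁ - conj ψ₂ := by
      rw [Finset.sum_add_distrib]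
      have e1 : ∑ a ∈ S, (m a : ℂ) / (w - a) = g - ψ₁ := eq_sub_of_add_eq h1.symm
      have e2 : ∑ a ∈ S, (m a : ℂ) / (w - conj a) = g - conj ψ₂ := eq_sub_of_add_eq h2'.symm
      rw [e1, e2]; ring
    rw [← Finset.mul_sum, ← Complex.im_sum, e]
    simp only [Complex.sub_im, Complex.add_im, Complex.conj_im]
    ring
  have hle : ∑ a ∈ S, w.im * ((m a : ℂ) / (w - a) + (m a : ℂ) / (w - conj a)).im ≤ -κ := by
    rw [← Finset.add_sum_erase S _ ha₀S]
    have hrest : ∑ a ∈ S.erase a₀, w.im * ((m a : ℂ) / (w - a) + (m a : ℂ) / (w - conj a)).im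
        ≤ 0 :=
      Finset.sum_nonpos fun a ha ↦
        im_mul_im_pair_nonpos (hout a (hS a (Finset.mem_of_mem_erase ha)).1) (m a)
    have hfirst := (im_mul_im_pair_le (hout a₀ ha₀) hw (hS a₀ ha₀S).2).1
    rw [← hκdef] at hfirst
    linarith
  have hψim : |ψ₂.im - ψ₁.im| ≤ κ / (2 * (|w.im| + 1)) := by
    calc |ψ₂.im - ψ₁.im| = |(ψ₁ - ψ₂).im| := by rw [Complex.sub_im, abs_sub_comm]
      _ ≤ ‖ψ₁ - ψ₂‖ := Complex.abs_im_le_norm _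
      _ ≤ κ / (2 * (|w.im| + 1)) := hψ
  have hprod : |w.im * (ψ₂.im - ψ₁.im)| ≤ |w.im| * (κ / (2 * (|w.im| + 1))) := by
    rw [abs_mul]; exact mul_le_mul_of_nonneg_left hψim (abs_nonneg _)
  have hlt : |w.im| * (κ / (2 * (|w.im| + 1))) < κ := by
    rw [← mul_div_assoc, div_lt_iff₀ (by positivity)]
    nlinarith [abs_nonneg w.im]
  have hD : w.im * (g.im + g.im - ψ₁.im + ψ₂.im) =
      2 * (w.im * g.im) + w.im * (ψ₂.im - ψ₁.im) := by ring
  rw [hsum, hD] at hle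
  have h3 := neg_le_abs (w.im * (ψ₂.im - ψ₁.im))
  rw [hgdef] at hle
  linarith

end XiDerivStrip

/-! ## `Ξ` and its derivatives -/

/-- `Ξ(z) = ξ(½ + iz)` is an (even) entire function (Titchmarsh §10.1). [cite: Titchmarsh1986, §10.1] -/
theorem XiDerivStrip.differentiable_xiUpper : Differentiable ℂ riemannXiUpper := by
  have h : riemannXiUpper = fun z ↦ riemannXi (1 / 2 + I * z) := rfl
  rw [h]
  exact differentiable_riemannXi.comp ((differentiable_id.const_mul I).const_add _)

/-- `Ξ^{(n)}(z) = iⁿ ξ^{(n)}(½ + iz)` (chain rule for the affine substitution `s = ½ + iz`).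
[cite: Conrey1983, §1 (p. 49)] -/
theorem iteratedDeriv_riemannXiUpper (n : ℕ) (z : ℂ) :
    iteratedDeriv n riemannXiUpper z = I ^ n * iteratedDeriv n riemannXi (1 / 2 + I * z) := by
  have h1 : riemannXiUpper = fun z ↦ (fun w ↦ riemannXi (1 / 2 + w)) (I * z) := rfl
  have hcd : ContDiff ℂ n (fun w : ℂ ↦ riemannXi (1 / 2 + w)) :=
    (differentiable_riemannXi.comp (differentiable_id.const_add _)).contDiff
  rw [h1, iteratedDeriv_comp_const_mul hcd I]
  simp only [iteratedDeriv_comp_const_add n riemannXi (1 / 2)]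

/-- Parity: `Ξ^{(m)}(−z) = (−1)^m Ξ^{(m)}(z)` (`Ξ` is even). [cite: Conrey1983, Lemma 2 proof (p. 52)] -/
theorem iteratedDeriv_riemannXiUpper_neg (m : ℕ) (z : ℂ) :
    iteratedDeriv m riemannXiUpper (-z) = (-1) ^ m * iteratedDeriv m riemannXiUpper z := by
  have h := iteratedDeriv_comp_neg m riemannXiUpper z
  have hfun : (fun x ↦ riemannXiUpper (-x)) = riemannXiUpper := funext riemannXiUpper_neg
  rw [hfun, smul_eq_mul] at h
  have h1 : ((-1 : ℂ) ^ m) * ((-1) ^ m) = 1 := by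
    rw [← mul_pow, neg_one_mul, neg_neg, one_pow]
  calc iteratedDeriv m riemannXiUpper (-z)
      = ((-1 : ℂ) ^ m * (-1) ^ m) * iteratedDeriv m riemannXiUpper (-z) := by rw [h1, one_mul]
    _ = (-1) ^ m * iteratedDeriv m riemannXiUpper z := by rw [h]; ring

/-- The odd derivatives of `Ξ` vanish at `0`. [cite: Conrey1983, §1 (p. 49)] -/
theorem iteratedDeriv_riemannXiUpper_zero_of_odd {n : ℕ} (hn : Odd n) :
    iteratedDeriv n riemannXiUpper 0 = 0 := by
  have h := iteratedDeriv_riemannXiUpper_neg n 0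
  rw [neg_zero, hn.neg_one_pow] at h
  have : (2 : ℂ) * iteratedDeriv n riemannXiUpper 0 = 0 := by linear_combination h
  simpa using this

/-- No derivative of `Ξ` vanishes identically: `Ξ^{(2k)}(0) = (−1)^k ξ^{(2k)}(½) ≠ 0` (tree:
`ξ^{(2k)}(½) > 0`, Titchmarsh §10.1), and `Ξ^{(2k+1)} ≡ 0` would force `Ξ^{(2k+2)} ≡ 0`.
[cite: Titchmarsh1986, §10.1] -/
theorem iteratedDeriv_riemannXiUpper_ne_zero (n : ℕ) : iteratedDeriv n riemannXiUpper ≠ 0 := by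
  have heven : ∀ k, iteratedDeriv (2 * k) riemannXiUpper ≠ 0 := by
    intro k h
    have h0 := congrFun h 0
    rw [iteratedDeriv_riemannXiUpper, Pi.zero_apply, mul_zero, add_zero] at h0
    have hne : iteratedDeriv (2 * k) riemannXi (1 / 2) ≠ 0 := fun h' ↦ by
      have := (iteratedDeriv_two_mul_riemannXi_half_pos k).1
      rw [h', Complex.zero_re] at this
      exact lt_irrefl _ this
    exact hne ((mul_eq_zero.1 h0).resolve_left (pow_ne_zero _ I_ne_zero))
  rcases Nat.even_or_odd n with ⟨k, rfl⟩ | ⟨k, rfl⟩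
  · rw [← two_mul]; exact heven k
  · intro h
    apply heven (k + 1)
    rw [show 2 * (k + 1) = (2 * k + 1) + 1 by ring, iteratedDeriv_succ, h]
    funext z
    exact deriv_const z (0 : ℂ)

/-- **`Ξ` is a real entire function of order `< 2`** in the tree's quantitative sense:
`‖Ξ(z)‖ ≤ C exp(‖z‖^{15/8})` (from `‖ξ(s)‖ ≤ C e^{A‖s‖ log(1+‖s‖)}`, Titchmarsh Thm. 2.12, tree
`riemannXi_order_le_one_holds`). [cite: Titchmarsh1986, Thm. 2.12 eq. (2.12.3)] -/
theorem exists_growth_riemannXiUpper :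
    ∃ ρ C : ℝ, 0 ≤ ρ ∧ ρ < 2 ∧ ∀ z, ‖riemannXiUpper z‖ ≤ C * Real.exp (‖z‖ ^ ρ) := by
  obtain ⟨A, C, h⟩ := riemannXi_order_le_one_holds
  obtain ⟨K₁, -, hK₁⟩ := exists_add_rpow_le (3 / 2) (3 / 2) (by norm_num) (by norm_num)
    (by norm_num)
  obtain ⟨K₂, -, hK₂⟩ := XiDerivStrip.exists_const_mul_rpow_le (2 * |A|) (p := 7 / 4)
    (p' := 15 / 8) (by norm_num) (by norm_num)
  refine ⟨15 / 8, |C| * Real.exp (2 * |A| * K₁ + K₂), by norm_num, by norm_num, fun z ↦ ?_⟩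
  set w : ℂ := 1 / 2 + I * z with hw
  have hwn : ‖w‖ ≤ ‖z‖ + 1 / 2 := by
    calc ‖w‖ ≤ ‖(1 / 2 : ℂ)‖ + ‖I * z‖ := norm_add_le _ _
      _ = ‖z‖ + 1 / 2 := by
          rw [norm_mul, Complex.norm_I, one_mul]
          have : ‖(1 / 2 : ℂ)‖ = 1 / 2 := by
            rw [show (1 / 2 : ℂ) = ((1 / 2 : ℝ) : ℂ) by push_cast; ring, Complex.norm_real]
            norm_num
          rw [this]; ring
  have hN0 : 0 ≤ ‖w‖ := norm_nonneg _
  have hlog : Real.log (1 + ‖w‖) ≤ 2 * (1 + ‖w‖) ^ (1 / 2 : ℝ) := by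
    have := Real.log_le_rpow_div (x := 1 + ‖w‖) (ε := 1 / 2) (by positivity) (by norm_num)
    rw [div_eq_mul_inv, show ((1 : ℝ) / 2)⁻¹ = 2 by norm_num] at this
    linarith
  have hexp : A * ‖w‖ * Real.log (1 + ‖w‖) ≤ 2 * |A| * K₁ + K₂ + ‖z‖ ^ (15 / 8 : ℝ) := by
    have hlog0 : 0 ≤ Real.log (1 + ‖w‖) := Real.log_nonneg (by linarith)
    have h1 : A * ‖w‖ * Real.log (1 + ‖w‖) ≤
        |A| * (1 + ‖w‖) * (2 * (1 + ‖w‖) ^ (1 / 2 : ℝ)) := by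
      calc A * ‖w‖ * Real.log (1 + ‖w‖) ≤ |A| * ‖w‖ * Real.log (1 + ‖w‖) := by
            gcongr; exact le_abs_self A
        _ ≤ |A| * (1 + ‖w‖) * Real.log (1 + ‖w‖) := by gcongr; linarith
        _ ≤ |A| * (1 + ‖w‖) * (2 * (1 + ‖w‖) ^ (1 / 2 : ℝ)) := by gcongr
    have h2 : (1 + ‖w‖) * (1 + ‖w‖) ^ (1 / 2 : ℝ) = (1 + ‖w‖) ^ (3 / 2 : ℝ) := by
      rw [show (3 / 2 : ℝ) = 1 + 1 / 2 by norm_num, Real.rpow_add (by positivity), Real.rpow_one]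
    have h3 : (1 + ‖w‖) ^ (3 / 2 : ℝ) ≤ K₁ + ‖z‖ ^ (7 / 4 : ℝ) := by
      have h3' := hK₁ ‖z‖ (norm_nonneg z)
      norm_num at h3'
      calc (1 + ‖w‖) ^ (3 / 2 : ℝ) ≤ (‖z‖ + 3 / 2) ^ (3 / 2 : ℝ) :=
            Real.rpow_le_rpow (by positivity) (by linarith) (by norm_num)
        _ ≤ K₁ + ‖z‖ ^ (7 / 4 : ℝ) := h3'
    have h4 := hK₂ ‖z‖ (norm_nonneg z)
    have hA0 : 0 ≤ 2 * |A| := by positivity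
    calc A * ‖w‖ * Real.log (1 + ‖w‖)
        ≤ |A| * (1 + ‖w‖) * (2 * (1 + ‖w‖) ^ (1 / 2 : ℝ)) := h1
      _ = 2 * |A| * ((1 + ‖w‖) * (1 + ‖w‖) ^ (1 / 2 : ℝ)) := by ring
      _ = 2 * |A| * (1 + ‖w‖) ^ (3 / 2 : ℝ) := by rw [h2]
      _ ≤ 2 * |A| * (K₁ + ‖z‖ ^ (7 / 4 : ℝ)) := mul_le_mul_of_nonneg_left h3 hA0
      _ = 2 * |A| * K₁ + 2 * |A| * ‖z‖ ^ (7 / 4 : ℝ) := by ring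
      _ ≤ 2 * |A| * K₁ + (K₂ + ‖z‖ ^ (15 / 8 : ℝ)) := by linarith
      _ = 2 * |A| * K₁ + K₂ + ‖z‖ ^ (15 / 8 : ℝ) := by ring
  calc ‖riemannXiUpper z‖ = ‖riemannXi w‖ := rfl
    _ ≤ C * Real.exp (A * ‖w‖ * Real.log (1 + ‖w‖)) := h w
    _ ≤ |C| * Real.exp (A * ‖w‖ * Real.log (1 + ‖w‖)) := by gcongr; exact le_abs_self C
    _ ≤ |C| * Real.exp (2 * |A| * K₁ + K₂ + ‖z‖ ^ (15 / 8 : ℝ)) := by gcongr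
    _ = |C| * Real.exp (2 * |A| * K₁ + K₂) * Real.exp (‖z‖ ^ (15 / 8 : ℝ)) := by
        rw [Real.exp_add]; ring

/-- The zeros of `Ξ` lie in the open strip `|Im z| < ½` (the zeros of `ξ` lie in `0 < Re s < 1`,
Titchmarsh §2.12). [cite: Titchmarsh1986, §2.12] -/
theorem abs_im_lt_half_of_riemannXiUpper_eq_zero {z : ℂ} (hz : riemannXiUpper z = 0) :
    |z.im| < 1 / 2 := by
  have h := (riemannXi_eq_zero_iff_holds (1 / 2 + I * z)).1 hz
  have hre : (1 / 2 + I * z).re = 1 / 2 - z.im := by simp; ring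
  rw [hre] at h
  rw [abs_lt]
  constructor <;> linarith [h.2.1, h.2.2]

/-- Every `Ξ^{(m)}` has a zero: `Ξ^{(m)}(0) = 0` for odd `m`; for even `m`, a zero-free `Ξ^{(m)}`
would have `Ξ^{(m+1)} ≡ 0` (tree `deriv_eq_zero_of_forall_ne_zero`, as `Ξ^{(m+1)}(0) = 0`).
[cite: KiKim2000, §2 p. 50] -/
theorem exists_iteratedDeriv_riemannXiUpper_eq_zero (m : ℕ) :
    ∃ a, iteratedDeriv m riemannXiUpper a = 0 := by
  rcases Nat.even_or_odd m with hm | hm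
  · by_contra hnone
    push Not at hnone
    obtain ⟨ρ, C, hρ0, hρ, hgr⟩ := exists_growth_riemannXiUpper
    obtain ⟨ρ', C', hρ'0, hρ', hgr'⟩ :=
      exists_growth_iteratedDeriv XiDerivStrip.differentiable_xiUpper hρ0 hρ hgr m
    have hodd : Odd (m + 1) := hm.add_one
    have h0 : deriv (iteratedDeriv m riemannXiUpper) 0 = 0 := by
      rw [← iteratedDeriv_succ]; exact iteratedDeriv_riemannXiUpper_zero_of_odd hodd
    have hall := deriv_eq_zero_of_forall_ne_zero
      (differentiable_iteratedDeriv_of_entire XiDerivStrip.differentiable_xiUpper m) hρ'0 hρ' hgr'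
      (im_iteratedDeriv_ofReal XiDerivStrip.differentiable_xiUpper im_riemannXiUpper_ofReal_holds m)
      hnone h0
    apply iteratedDeriv_riemannXiUpper_ne_zero (m + 1)
    rw [iteratedDeriv_succ]
    funext z
    exact hall z
  · exact ⟨0, iteratedDeriv_riemannXiUpper_zero_of_odd hm⟩

/-! ## Conrey's Lemma 2, first statement: the zeros of `ξ^{(m)}` lie in `0 < σ < 1` -/

/-- Ξ-form: **every zero of every `Ξ^{(k)}` has `|Im z| < ½`.**
[cite: Conrey1983, Lemma 2 (p. 52)] -/
theorem abs_im_lt_half_of_iteratedDeriv_riemannXiUpper_eq_zero (k : ℕ) {z : ℂ}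
    (hz : iteratedDeriv k riemannXiUpper z = 0) : |z.im| < 1 / 2 := by
  obtain ⟨ρ, C, hρ0, hρ, hgr⟩ := exists_growth_riemannXiUpper
  exact XiDerivStrip.abs_im_lt_of_iteratedDeriv_eq_zero XiDerivStrip.differentiable_xiUpper hρ0 hρ
    hgr im_riemannXiUpper_ofReal_holds iteratedDeriv_riemannXiUpper_ne_zero (by norm_num)
    (fun z hz ↦ abs_im_lt_half_of_riemannXiUpper_eq_zero hz) k hz

/-- **Conrey 1983, Lemma 2 (first statement), every `m`: any zero of `ξ^{(m)}(s)` satisfies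
`0 < σ < 1`.** [cite: Conrey1983, Lemma 2 (p. 52)] -/
theorem Conrey1983_lemma2_strip (m : ℕ) {s : ℂ} (hs : iteratedDeriv m riemannXi s = 0) :
    0 < s.re ∧ s.re < 1 := by
  set z : ℂ := -I * (s - 1 / 2) with hz
  have hsz : 1 / 2 + I * z = s := by
    rw [hz]; linear_combination (-(s - 1 / 2)) * I_sq
  have h := abs_im_lt_half_of_iteratedDeriv_riemannXiUpper_eq_zero m (z := z)
    (by rw [iteratedDeriv_riemannXiUpper, hsz, hs, mul_zero])
  have hzim : z.im = 1 / 2 - s.re := by simp [hz]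
  rw [hzim, abs_lt] at h
  constructor <;> linarith [h.1, h.2]

/-- `ξ^{(m)}(s) ≠ 0` for `Re s ≥ 1`. [cite: Conrey1983, Lemma 2 (p. 52)] -/
theorem iteratedDeriv_riemannXi_ne_zero_of_one_le_re (m : ℕ) {s : ℂ} (hs : 1 ≤ s.re) :
    iteratedDeriv m riemannXi s ≠ 0 := fun h ↦ by
  have := (Conrey1983_lemma2_strip m h).2; linarith

/-- `ξ^{(m)}(s) ≠ 0` for `Re s ≤ 0`. [cite: Conrey1983, Lemma 2 (p. 52)] -/
theorem iteratedDeriv_riemannXi_ne_zero_of_re_le_zero (m : ℕ) {s : ℂ} (hs : s.re ≤ 0) :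
    iteratedDeriv m riemannXi s ≠ 0 := fun h ↦ by
  have := (Conrey1983_lemma2_strip m h).1; linarith

/-- `m = 2`, `deriv`-form: every zero of `ξ″` lies in the open critical strip.
[cite: Conrey1983, Lemma 2 (p. 52)] -/
theorem deriv2_riemannXi_eq_zero_re_mem {s : ℂ} (hs : deriv (deriv riemannXi) s = 0) :
    0 < s.re ∧ s.re < 1 := by
  refine Conrey1983_lemma2_strip 2 ?_
  rw [show (2 : ℕ) = 1 + 1 from rfl, iteratedDeriv_succ, iteratedDeriv_one]; exact hs

/-- `Ξ′`-form (the unconditional rung of the `Ξ′`-crux): every zero of `Ξ′` has `|Im z| < ½`.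
[cite: Conrey1983, Lemma 2 (p. 52)] -/
theorem abs_im_lt_half_of_deriv_riemannXiUpper_eq_zero {z : ℂ} (hz : deriv riemannXiUpper z = 0) :
    |z.im| < 1 / 2 :=
  abs_im_lt_half_of_iteratedDeriv_riemannXiUpper_eq_zero 1 (by rw [iteratedDeriv_one]; exact hz)

/-! ## Conrey's inequality `Re ξ^{(m+1)}/ξ^{(m)} > 0` -/

/-- The sign computation: if `Re s > ½` and every zero `a` of `Ξ^{(m)}` has `|Im a| < Re s − ½`,
then `Re (ξ^{(m+1)}(s)/ξ^{(m)}(s)) > 0` (`= Im (Ξ_m′/Ξ_m)(z)` at `z = −i(s − ½)`, `Im z = ½ − Re s < 0`,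
a point outside every Jensen disc of `Ξ^{(m)}`). [cite: Conrey1983, Lemma 2 proof (p. 52)] -/
theorem XiDerivStrip.re_iteratedDeriv_succ_div_pos (m : ℕ) {s : ℂ} (hs : 1 / 2 < s.re)
    (hout : ∀ a, iteratedDeriv m riemannXiUpper a = 0 → |a.im| < s.re - 1 / 2) :
    0 < (iteratedDeriv (m + 1) riemannXi s / iteratedDeriv m riemannXi s).re := by
  obtain ⟨ρ, C, hρ0, hρ, hgr⟩ := exists_growth_riemannXiUpper
  obtain ⟨ρ', C', hρ'0, hρ', hgr'⟩ :=
    exists_growth_iteratedDeriv XiDerivStrip.differentiable_xiUpper hρ0 hρ hgr m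
  set f : ℂ → ℂ := iteratedDeriv m riemannXiUpper with hf
  set w : ℂ := -I * (s - 1 / 2) with hw
  have hsz : 1 / 2 + I * w = s := by
    rw [hw]; linear_combination (-(s - 1 / 2)) * I_sq
  have hwim : w.im = 1 / 2 - s.re := by simp [hw]
  have hwim_neg : w.im < 0 := by rw [hwim]; linarith
  have hout' : ∀ a, f a = 0 → |a.im| < ‖w - a.re‖ := by
    intro a ha
    have h1 := hout a ha
    have h2 : |(w - (a.re : ℂ)).im| ≤ ‖w - (a.re : ℂ)‖ := Complex.abs_im_le_norm _
    have h3 : (w - (a.re : ℂ)).im = w.im := by simp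
    rw [h3, hwim, abs_of_neg (by linarith)] at h2
    linarith
  have hsign := XiDerivStrip.im_mul_im_logDeriv_neg
    (differentiable_iteratedDeriv_of_entire XiDerivStrip.differentiable_xiUpper m) hρ'0 hρ' hgr'
    (im_iteratedDeriv_ofReal XiDerivStrip.differentiable_xiUpper im_riemannXiUpper_ofReal_holds m)
    (exists_iteratedDeriv_riemannXiUpper_eq_zero m) hwim_neg.ne hout'
  have hpos : 0 < (deriv f w / f w).im := pos_of_mul_neg_right hsign hwim_neg.le
  have hq : deriv f w / f w =
      I * (iteratedDeriv (m + 1) riemannXi s / iteratedDeriv m riemannXi s) := by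
    rw [hf, ← iteratedDeriv_succ, iteratedDeriv_riemannXiUpper, iteratedDeriv_riemannXiUpper, hsz,
      pow_succ, mul_assoc, mul_div_mul_left _ _ (pow_ne_zero _ I_ne_zero), mul_div_assoc]
  rw [hq, Complex.I_mul_im] at hpos
  exact hpos

/-- **Conrey 1983, proof of Lemma 2: `Re (ξ^{(m+1)}(s)/ξ^{(m)}(s)) > 0` for `Re s ≥ 1`**, every `m`
(in particular `ξ^{(m)}(s) ≠ 0` and `ξ^{(m+1)}(s) ≠ 0` there). [cite: Conrey1983, Lemma 2 proof (p. 52)] -/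
theorem re_iteratedDeriv_succ_div_pos_of_one_le_re (m : ℕ) {s : ℂ} (hs : 1 ≤ s.re) :
    0 < (iteratedDeriv (m + 1) riemannXi s / iteratedDeriv m riemannXi s).re :=
  XiDerivStrip.re_iteratedDeriv_succ_div_pos m (by linarith) fun a ha ↦ by
    have := abs_im_lt_half_of_iteratedDeriv_riemannXiUpper_eq_zero m ha; linarith

/-- `m = 1`, `deriv`-form: **`Re (ξ″(s)/ξ′(s)) > 0` for `Re s ≥ 1`** — the quantity
`∂_σ log |ξ′(σ + it)| = Re ξ″/ξ′` of the horizontal-monotonicity criterion for `ξ′`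
(Matiyasevich–Saidak–Zvengrowski, Lemma 2.3), unconditionally positive to the right of the strip.
[cite: Conrey1983, Lemma 2 proof (p. 52)] -/
theorem re_deriv2_div_deriv_riemannXi_pos_of_one_le_re {s : ℂ} (hs : 1 ≤ s.re) :
    0 < (deriv (deriv riemannXi) s / deriv riemannXi s).re := by
  have h := re_iteratedDeriv_succ_div_pos_of_one_le_re 1 hs
  rwa [iteratedDeriv_succ, iteratedDeriv_one] at h

/-! ## Under RH: all zeros of all `ξ^{(m)}` on the critical line (Conrey 1983, p. 49, "for any `m`") -/

/-- Ξ-form: **RH ⇒ every zero of every `Ξ^{(k)}` is real** (real zeros stay real under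
differentiation in the Laguerre–Pólya class; tree `abs_im_le_of_iteratedDeriv_eq_zero` with
`Δ = 0`). [cite: Conrey1983, §1 (p. 49)] -/
theorem riemannHypothesis_imp_iteratedDeriv_riemannXiUpper_zeros_real (hRH : RiemannHypothesis)
    (k : ℕ) {z : ℂ} (hz : iteratedDeriv k riemannXiUpper z = 0) : z.im = 0 := by
  obtain ⟨ρ, C, hρ0, hρ, hgr⟩ := exists_growth_riemannXiUpper
  have hreal0 : ∀ z, riemannXiUpper z = 0 → |z.im| ≤ 0 := fun z hz ↦ by
    rw [(riemannHypothesis_iff_im_eq_zero_of_riemannXiUpper_eq_zero_holds.mp hRH) z hz, abs_zero]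
  have h := abs_im_le_of_iteratedDeriv_eq_zero XiDerivStrip.differentiable_xiUpper hρ0 hρ hgr
    im_riemannXiUpper_ofReal_holds iteratedDeriv_riemannXiUpper_ne_zero le_rfl hreal0 k hz
  exact abs_nonpos_iff.mp h

/-- **RH ⇒ all zeros of `ξ^{(m)}` have real part `½`, for every `m`** (Conrey 1983, p. 49: "It can be
shown that the Riemann hypothesis implies that all of the zeros of `ξ^{(m)}(s)` … have real part `½`
for any `m`"; Levinson–Montgomery 1974). The case `m = 1` is the tree's
`riemannHypothesis_imp_xiDeriv_zeros_on_line_holds`. [cite: Conrey1983, §1 (p. 49)] -/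
theorem riemannHypothesis_imp_iteratedDeriv_riemannXi_zeros_on_line (hRH : RiemannHypothesis)
    (m : ℕ) {s : ℂ} (hs : iteratedDeriv m riemannXi s = 0) : s.re = 1 / 2 := by
  set z : ℂ := -I * (s - 1 / 2) with hz
  have hsz : 1 / 2 + I * z = s := by
    rw [hz]; linear_combination (-(s - 1 / 2)) * I_sq
  have h := riemannHypothesis_imp_iteratedDeriv_riemannXiUpper_zeros_real hRH m (z := z)
    (by rw [iteratedDeriv_riemannXiUpper, hsz, hs, mul_zero])
  have hzim : z.im = 1 / 2 - s.re := by simp [hz]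
  rw [hzim] at h
  linarith

/-- `Ξ′`-form: **RH ⇒ every zero of `Ξ′` is real** (the statement `XiPrimeOnLine` of the `Ξ′`-crux is
RH-implied). [cite: Conrey1983, §1 (p. 49)] -/
theorem riemannHypothesis_imp_deriv_riemannXiUpper_zeros_real (hRH : RiemannHypothesis) :
    ∀ z : ℂ, deriv riemannXiUpper z = 0 → z.im = 0 := fun _ hz ↦
  riemannHypothesis_imp_iteratedDeriv_riemannXiUpper_zeros_real hRH 1
    (by rw [iteratedDeriv_one]; exact hz)

/-- **RH ⇒ `Re (ξ^{(m+1)}(s)/ξ^{(m)}(s)) > 0` for `Re s > ½`**, every `m` (under RH the zeros of `Ξ^{(m)}`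
are real, so every `z` with `Im z ≠ 0` is outside all Jensen discs; Conrey's computation, p. 52, with the
zeros on the line). [cite: Conrey1983, §1 (p. 49) and Lemma 2 proof (p. 52)] -/
theorem riemannHypothesis_imp_re_iteratedDeriv_succ_div_pos (hRH : RiemannHypothesis) (m : ℕ)
    {s : ℂ} (hs : 1 / 2 < s.re) :
    0 < (iteratedDeriv (m + 1) riemannXi s / iteratedDeriv m riemannXi s).re :=
  XiDerivStrip.re_iteratedDeriv_succ_div_pos m hs fun a ha ↦ by
    rw [riemannHypothesis_imp_iteratedDeriv_riemannXiUpper_zeros_real hRH m ha, abs_zero]; linarith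

/-- `m = 1`, `deriv`-form: **RH ⇒ `Re (ξ″(s)/ξ′(s)) > 0` for `Re s > ½`** (the infinitesimal form of the
horizontal monotonicity of `|ξ′(σ + it)|` on the right half of the strip, RH-implied).
[cite: Conrey1983, §1 (p. 49) and Lemma 2 proof (p. 52)] -/
theorem riemannHypothesis_imp_re_deriv2_div_deriv_riemannXi_pos (hRH : RiemannHypothesis) {s : ℂ}
    (hs : 1 / 2 < s.re) : 0 < (deriv (deriv riemannXi) s / deriv riemannXi s).re := by
  have h := riemannHypothesis_imp_re_iteratedDeriv_succ_div_pos hRH 1 hs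
  rwa [iteratedDeriv_succ, iteratedDeriv_one] at h

end Literature.NumberTheory.LFunctions

end
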